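import Summits.NavierStokesRegularity.NavierStokesRegularity.Theorems.TypeICertificateLadderTargetDepletionLambPairing
import Literature.Analysis.FluidPDE.TaoEnstrophyLocalisationProofs
import Literature.Analysis.FluidPDE.VectorCalculusProofs
import Literature.Analysis.Approximation.PolynomialCkDensity
import Literature.Analysis.Calculus.HardyExteriorDecay
import HarnessLib

/-!
# Crux `Target` (stmt-NavierStokesRegularity-1217), line `depletion_ladder`, stub S1: the palinstrophy
# identity `‖curl ω‖₂ = ‖∇ω‖₂` in the REGISTERED class (`u ∈ C²`, i.e. `ω = curl u ∈ C¹`)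

`--supports stmt-NavierStokesRegularity-1217` (seat leafhand-ns-poloidalwindowdoor-2 g1, cell decomp-ns).

The registered stub S1 `stub_depletionBelowHalf` (skeleton `Cruxes/Target/Lines/depletion_ladder.lean`)
measures the stretching integral against `M‖ω‖₂‖∇ω‖₂` for `u ∈ C²`. Every rewrite of S1's functional
in Lamb variables (`∫⟪ω, Du ω⟫ = ∫⟪u, ω × curl ω⟫`, `…TargetDepletionLambPairing`, on the exact class)
pays in `‖curl ω‖₂`, and the conversion `‖curl ω‖₂ = ‖∇ω‖₂` (the divergence-free `ω` has no
compression part) is in the tree only for `u ∈ C³` (`integral_norm_curl_curl_sq_eq`, via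
`integral_norm_curl_sq_eq_integral_frobeniusNormSq`, which integrates `div((ω·∇)ω)` by parts and so
needs `ω ∈ C²`), so the alignment laws `R² + D ≤ 1`, `R² + A ≤ 1` of
`…TargetDepletionAlignmentIdentity` are stated one derivative above the registered class. This file
removes that derivative:

* `exists_contDiff_two_approx` — `C¹` approximation with derivatives on a compact set by `C²` (indeed
  `C^∞`) fields (Trèves 1967, Ch. 15: cut-off to `C¹_c`, then regularisation; tree
  `Literature.Analysis.Approximation.exists_forall_norm_iteratedFDeriv_convolution_sub_self_le`).
* `integral_mul_frobeniusNormSq_sub_norm_curl_sq_eq` — **the weak form for `C¹` fields**: for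
  `W ∈ C¹(ℝ³; ℝ³)` divergence free and `φ ∈ C¹_c`,
  `∫ φ (|DW|²_F − |curl W|²) = −∫ Dφ (DW W)`, i.e. `div((W·∇)W) = tr (DW ∘ DW)` in the sense of
  distributions (the tree's `C²` identity `integral_mul_trace_comp_sub_divergence_sq` applied to the
  approximants, dominated convergence on `tsupport φ`).
* `integral_norm_curl_sq_eq_of_contDiff_one` — **`∫‖curl W‖² = ∫|DW|²_F` for `W ∈ C¹` divergence
  free with `W ∈ L²`, `DW ∈ L²`** (radial cut-offs `χ_k`; the error `∫ Dχ_k (DW W)` is dominated by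
  `C₁(|DW|²_F + ‖W‖²)` and vanishes pointwise; no decay of `W` at infinity beyond `W ∈ L²`).
* `integral_norm_curl_curl_sq_eq_of_contDiff_two` — the registered-class palinstrophy identity:
  for `u ∈ C²` with `curl u ∈ L²`, `∇ curl u ∈ L²`, `‖curl curl u‖₂² = ‖∇ curl u‖₂²`.

HONEST LABEL: helper (regularity bookkeeping for S1's normalisation); closes no registered stub; no
Navier–Stokes content; `Target`, S3 and NS regularity remain OPEN.

References: F. Trèves, *Topological Vector Spaces, Distributions and Kernels* (1967), Ch. 15,
Lemma 15.1 and Cor. 1; G. P. Galdi, *Steady-State Navier–Stokes* (2011), §II.6 (whole-space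
`‖∇v‖₂ = ‖curl v‖₂ + ‖div v‖₂`). [folklore]
-/

noncomputable section

-- the summit and its single sub-problem share the name (CONVENTIONS §1)
set_option linter.dupNamespace false

open Set Filter Topology MeasureTheory
open scoped RealInnerProductSpace Convolution
open Literature.Analysis.FluidPDE

namespace Summit.NavierStokesRegularity.NavierStokesRegularity.Theorems.DepletionLadder.C1DivCurl

variable {W : EuclideanSpace ℝ (Fin 3) → EuclideanSpace ℝ (Fin 3)}

/-! ## `C¹` approximation with derivatives on a compact set -/

/-- **`C¹` approximation on a compact set** (Trèves 1967, Ch. 15, Lemma 15.1 / Cor. 1 with a smooth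
cut-off): a `C¹` field `W` is, on any compact `K`, within `ε` of a `C²` field `g` together with its
derivative: `‖g x − W x‖ ≤ ε`, `‖Dg x − DW x‖ ≤ ε` for `x ∈ K`. [folklore] -/
theorem exists_contDiff_two_approx (hW : ContDiff ℝ 1 W) {K : Set (EuclideanSpace ℝ (Fin 3))}
    (hK : IsCompact K) {ε : ℝ} (hε : 0 < ε) :
    ∃ g : EuclideanSpace ℝ (Fin 3) → EuclideanSpace ℝ (Fin 3), ContDiff ℝ 2 g ∧
      (∀ x ∈ K, ‖g x - W x‖ ≤ ε) ∧ (∀ x ∈ K, ‖fderiv ℝ g x - fderiv ℝ W x‖ ≤ ε) := by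
  obtain ⟨f, hf, hfc, hfW⟩ := Literature.Analysis.Approximation.exists_contDiff_hasCompactSupport_eventuallyEq
    (k := 1) isOpen_univ hW.contDiffOn hK (subset_univ K)
  obtain ⟨R, η, δ, hη, hδ, h⟩ :=
    Literature.Analysis.Approximation.exists_forall_norm_iteratedFDeriv_convolution_sub_self_le
      (μ := (volume : Measure (EuclideanSpace ℝ (Fin 3)))) hK 1 hf hfc hε
  let φb : ContDiffBump (0 : EuclideanSpace ℝ (Fin 3)) := ⟨δ / 2, δ, half_pos hδ, half_lt_self hδ⟩
  have hk := h φb le_rfl (φb.normed volume) φb.continuous_normed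
    (fun t _ => by rw [sub_self, abs_zero]; exact hη.le)
  set g : EuclideanSpace ℝ (Fin 3) → EuclideanSpace ℝ (Fin 3) :=
    φb.normed volume ⋆[ContinuousLinearMap.lsmul ℝ ℝ, volume] f with hgdef
  have hgC : ContDiff ℝ 2 g :=
    φb.hasCompactSupport_normed.contDiff_convolution_left _ φb.contDiff_normed
      hf.continuous.locallyIntegrable
  have hf1 : Differentiable ℝ f := hf.differentiable one_ne_zero
  have hg1 : Differentiable ℝ g := hgC.differentiable (by norm_num)
  refine ⟨g, hgC, fun x hx => ?_, fun x hx => ?_⟩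
  · have h0 := hk 0 (by norm_num) x hx
    rw [norm_iteratedFDeriv_zero, Pi.sub_apply, (hfW x hx).eq_of_nhds] at h0
    exact h0
  · have h1 := hk 1 le_rfl x hx
    rw [← norm_iteratedFDeriv_fderiv, norm_iteratedFDeriv_zero] at h1
    have hsub : fderiv ℝ (g - f) x = fderiv ℝ g x - fderiv ℝ f x := by
      rw [show g - f = fun y => g y - f y from rfl]
      exact fderiv_sub (hg1 x) (hf1 x)
    rw [hsub, (hfW x hx).fderiv_eq] at h1
    exact h1

/-! ## The weak `div`–`curl` identity for `C¹` fields -/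

/-- The quadratic form `L ↦ tr (L ∘ L) − (tr L)²` is continuous. [folklore] -/
theorem continuous_trace_comp_sub_sq :
    Continuous fun L : EuclideanSpace ℝ (Fin 3) →L[ℝ] EuclideanSpace ℝ (Fin 3) =>
      traceCLM (L.comp L) - traceCLM L ^ 2 := by
  refine (traceCLM.continuous.comp ?_).sub (traceCLM.continuous.pow 2)
  exact ((ContinuousLinearMap.compL ℝ (EuclideanSpace ℝ (Fin 3)) (EuclideanSpace ℝ (Fin 3))
    (EuclideanSpace ℝ (Fin 3))).continuous₂).comp (continuous_id.prodMk continuous_id)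

/-- Crude bound for the quadratic form: `|tr (L ∘ L) − (tr L)²| ≤ ‖tr‖ ‖L‖² + (‖tr‖ ‖L‖)²`. [folklore] -/
theorem abs_trace_comp_sub_sq_le (L : EuclideanSpace ℝ (Fin 3) →L[ℝ] EuclideanSpace ℝ (Fin 3)) :
    |traceCLM (L.comp L) - traceCLM L ^ 2| ≤
      ‖(traceCLM : (EuclideanSpace ℝ (Fin 3) →L[ℝ] EuclideanSpace ℝ (Fin 3)) →L[ℝ] ℝ)‖ * ‖L‖ ^ 2 +
        (‖(traceCLM : (EuclideanSpace ℝ (Fin 3) →L[ℝ] EuclideanSpace ℝ (Fin 3)) →L[ℝ] ℝ)‖ * ‖L‖) ^ 2 := by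
  have h1 : |traceCLM (L.comp L)| ≤ ‖(traceCLM : (EuclideanSpace ℝ (Fin 3) →L[ℝ]
      EuclideanSpace ℝ (Fin 3)) →L[ℝ] ℝ)‖ * ‖L‖ ^ 2 := by
    calc |traceCLM (L.comp L)| = ‖traceCLM (L.comp L)‖ := (Real.norm_eq_abs _).symm
      _ ≤ ‖(traceCLM : (EuclideanSpace ℝ (Fin 3) →L[ℝ] EuclideanSpace ℝ (Fin 3)) →L[ℝ] ℝ)‖ *
          ‖L.comp L‖ := ContinuousLinearMap.le_opNorm _ _
      _ ≤ ‖(traceCLM : (EuclideanSpace ℝ (Fin 3) →L[ℝ] EuclideanSpace ℝ (Fin 3)) →L[ℝ] ℝ)‖ *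
          (‖L‖ * ‖L‖) := by
          gcongr; exact ContinuousLinearMap.opNorm_comp_le _ _
      _ = _ := by ring
  have h2 : |traceCLM L| ≤ ‖(traceCLM : (EuclideanSpace ℝ (Fin 3) →L[ℝ]
      EuclideanSpace ℝ (Fin 3)) →L[ℝ] ℝ)‖ * ‖L‖ := by
    rw [← Real.norm_eq_abs]; exact ContinuousLinearMap.le_opNorm _ _
  have h3 : traceCLM L ^ 2 ≤ (‖(traceCLM : (EuclideanSpace ℝ (Fin 3) →L[ℝ]
      EuclideanSpace ℝ (Fin 3)) →L[ℝ] ℝ)‖ * ‖L‖) ^ 2 := by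
    rw [← sq_abs (traceCLM L)]
    exact pow_le_pow_left₀ (abs_nonneg _) h2 2
  calc |traceCLM (L.comp L) - traceCLM L ^ 2| ≤ |traceCLM (L.comp L)| + |traceCLM L ^ 2| := abs_sub _ _
    _ ≤ _ := by rw [abs_of_nonneg (sq_nonneg (traceCLM L))]; exact add_le_add h1 h3

/-- **The weak `div`–`curl` identity for `C¹` divergence-free fields.** For `W ∈ C¹(ℝ³; ℝ³)` with
`div W = 0` and a compactly supported `φ ∈ C¹`:
`∫ φ (|DW|²_F − |curl W|²) = −∫ Dφ (DW W)` — i.e. `div ((W·∇)W) = tr (DW ∘ DW) = |DW|²_F − |curl W|²`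
in the sense of distributions. Proof: the tree's `C²` identity
`∫ φ (tr (Dg ∘ Dg) − (div g)²) = −∫ Dφ ((g·∇)g − (div g) g)` (`integral_mul_trace_comp_sub_divergence_sq`)
for `C²` approximants `g → W` in `C¹(tsupport φ)`, and dominated convergence. [folklore] -/
theorem integral_mul_frobeniusNormSq_sub_norm_curl_sq_eq (hW : ContDiff ℝ 1 W)
    (hdiv : VectorCalculus.IsDivFree W) {φ : EuclideanSpace ℝ (Fin 3) → ℝ} (hφ : ContDiff ℝ 1 φ)
    (hφc : HasCompactSupport φ) :
    ∫ x, φ x * (frobeniusNormSq (fderiv ℝ W x) - ‖curl W x‖ ^ 2) =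
      -∫ x, fderiv ℝ φ x (fderiv ℝ W x (W x)) := by
  set K : Set (EuclideanSpace ℝ (Fin 3)) := tsupport φ with hKdef
  have hK : IsCompact K := hφc
  set τ : ℝ := ‖(traceCLM : (EuclideanSpace ℝ (Fin 3) →L[ℝ] EuclideanSpace ℝ (Fin 3)) →L[ℝ] ℝ)‖
    with hτdef
  have hτ0 : 0 ≤ τ := by rw [hτdef]; positivity
  set Q : (EuclideanSpace ℝ (Fin 3) →L[ℝ] EuclideanSpace ℝ (Fin 3)) → ℝ :=
    fun L => traceCLM (L.comp L) - traceCLM L ^ 2 with hQdef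
  have hQc : Continuous Q := continuous_trace_comp_sub_sq
  have hQW : ∀ x, Q (fderiv ℝ W x) = frobeniusNormSq (fderiv ℝ W x) - ‖curl W x‖ ^ 2 := by
    intro x
    have h1 := frobeniusNormSq_fderiv_eq_sq_norm_curl_add_trace W x
    have h2 : traceCLM (fderiv ℝ W x) = 0 := by rw [← divergence_eq_traceCLM]; exact hdiv x
    simp only [hQdef, h2]
    linarith
  have hQbd : ∀ L : EuclideanSpace ℝ (Fin 3) →L[ℝ] EuclideanSpace ℝ (Fin 3),
      |Q L| ≤ τ * ‖L‖ ^ 2 + (τ * ‖L‖) ^ 2 := fun L => abs_trace_comp_sub_sq_le L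
  have hWc : Continuous W := hW.continuous
  have hDWc : Continuous (fderiv ℝ W) := hW.continuous_fderiv one_ne_zero
  obtain ⟨A, hA⟩ := hK.exists_bound_of_continuousOn hWc.continuousOn
  obtain ⟨B, hB⟩ := hK.exists_bound_of_continuousOn hDWc.continuousOn
  have hεn : ∀ n : ℕ, (0 : ℝ) < 1 / ((n : ℝ) + 1) := fun n => by positivity
  have hεn1 : ∀ n : ℕ, 1 / ((n : ℝ) + 1) ≤ 1 := fun n => by
    rw [div_le_one (by positivity)]
    have : (0 : ℝ) ≤ n := Nat.cast_nonneg n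
    linarith
  choose g hgC hg0 hg1 using fun n : ℕ => exists_contDiff_two_approx hW hK (hεn n)
  have hg1C : ∀ n, ContDiff ℝ 1 (g n) := fun n => (hgC n).of_le one_le_two
  have hgd : ∀ n, Differentiable ℝ (g n) := fun n => (hg1C n).differentiable one_ne_zero
  have hgK : ∀ n, ∀ x ∈ K, ‖g n x‖ ≤ |A| + 1 := by
    intro n x hx
    calc ‖g n x‖ = ‖(g n x - W x) + W x‖ := by rw [sub_add_cancel]
      _ ≤ ‖g n x - W x‖ + ‖W x‖ := norm_add_le _ _
      _ ≤ 1 + |A| := add_le_add ((hg0 n x hx).trans (hεn1 n)) ((hA x hx).trans (le_abs_self A))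
      _ = |A| + 1 := add_comm _ _
  have hDgK : ∀ n, ∀ x ∈ K, ‖fderiv ℝ (g n) x‖ ≤ |B| + 1 := by
    intro n x hx
    calc ‖fderiv ℝ (g n) x‖ = ‖(fderiv ℝ (g n) x - fderiv ℝ W x) + fderiv ℝ W x‖ := by
          rw [sub_add_cancel]
      _ ≤ ‖fderiv ℝ (g n) x - fderiv ℝ W x‖ + ‖fderiv ℝ W x‖ := norm_add_le _ _
      _ ≤ 1 + |B| := add_le_add ((hg1 n x hx).trans (hεn1 n)) ((hB x hx).trans (le_abs_self B))
      _ = |B| + 1 := add_comm _ _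
  have htend0 : Tendsto (fun n : ℕ => (1 : ℝ) / ((n : ℝ) + 1)) atTop (𝓝 0) :=
    tendsto_one_div_add_atTop_nhds_zero_nat
  have hgx : ∀ x ∈ K, Tendsto (fun n => g n x) atTop (𝓝 (W x)) := by
    intro x hx
    rw [tendsto_iff_norm_sub_tendsto_zero]
    exact squeeze_zero (fun n => norm_nonneg _) (fun n => hg0 n x hx) htend0
  have hDgx : ∀ x ∈ K, Tendsto (fun n => fderiv ℝ (g n) x) atTop (𝓝 (fderiv ℝ W x)) := by
    intro x hx
    rw [tendsto_iff_norm_sub_tendsto_zero]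
    exact squeeze_zero (fun n => norm_nonneg _) (fun n => hg1 n x hx) htend0
  have hφK : ∀ x, x ∉ K → φ x = 0 := fun x hx => image_eq_zero_of_notMem_tsupport hx
  have hDφK : ∀ x, x ∉ K → fderiv ℝ φ x = 0 := fun x hx =>
    image_eq_zero_of_notMem_tsupport fun h => hx (tsupport_fderiv_subset ℝ h)
  have hid : ∀ n, ∫ x, φ x * Q (fderiv ℝ (g n) x) =
      -∫ x, fderiv ℝ φ x (fderiv ℝ (g n) x (g n x) - VectorCalculus.divergence (g n) x • g n x) := by
    intro n
    have h := integral_mul_trace_comp_sub_divergence_sq (hgC n) hφ hφc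
    simpa only [hQdef, divergence_eq_traceCLM] using h
  set D₁ : ℝ := τ * (|B| + 1) ^ 2 + (τ * (|B| + 1)) ^ 2 with hD₁
  have hL : Tendsto (fun n => ∫ x, φ x * Q (fderiv ℝ (g n) x)) atTop
      (𝓝 (∫ x, φ x * (frobeniusNormSq (fderiv ℝ W x) - ‖curl W x‖ ^ 2))) := by
    refine tendsto_integral_of_dominated_convergence (fun x => D₁ * ‖φ x‖) (fun n => ?_) ?_
      (fun n => ae_of_all _ fun x => ?_) (ae_of_all _ fun x => ?_)
    · exact (hφ.continuous.mul (hQc.comp ((hgC n).continuous_fderiv (by norm_num))))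
        |>.aestronglyMeasurable
    · exact (continuous_const.mul hφ.continuous.norm).integrable_of_hasCompactSupport
        hφc.norm.mul_left
    · by_cases hx : x ∈ K
      · rw [norm_mul, mul_comm]
        refine mul_le_mul_of_nonneg_right ?_ (norm_nonneg _)
        rw [Real.norm_eq_abs]
        refine (hQbd _).trans ?_
        have hL1 : ‖fderiv ℝ (g n) x‖ ≤ |B| + 1 := hDgK n x hx
        have hL0 : 0 ≤ ‖fderiv ℝ (g n) x‖ := norm_nonneg _
        rw [hD₁]
        gcongr
      · simp [hφK x hx]
    · by_cases hx : x ∈ K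
      · have h := ((hQc.tendsto _).comp (hDgx x hx)).const_mul (φ x)
        rw [Function.comp_def, hQW x] at h
        exact h
      · rw [hφK x hx]
        simp only [zero_mul]
        exact tendsto_const_nhds
  set D₂ : ℝ := (|B| + 1) * (|A| + 1) + τ * (|B| + 1) * (|A| + 1) with hD₂
  have hR : Tendsto (fun n => ∫ x, fderiv ℝ φ x
      (fderiv ℝ (g n) x (g n x) - VectorCalculus.divergence (g n) x • g n x)) atTop
      (𝓝 (∫ x, fderiv ℝ φ x (fderiv ℝ W x (W x)))) := by
    refine tendsto_integral_of_dominated_convergence (fun x => D₂ * ‖fderiv ℝ φ x‖) (fun n => ?_) ?_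
      (fun n => ae_of_all _ fun x => ?_) (ae_of_all _ fun x => ?_)
    · refine ((hφ.continuous_fderiv one_ne_zero).clm_apply ?_).aestronglyMeasurable
      exact (((hgC n).continuous_fderiv (by norm_num)).clm_apply (hgC n).continuous).sub
        ((contDiff_divergence (n := 1) (hgC n)).continuous.smul (hgC n).continuous)
    · exact (continuous_const.mul (hφ.continuous_fderiv one_ne_zero).norm)
        |>.integrable_of_hasCompactSupport (hφc.fderiv (𝕜 := ℝ)).norm.mul_left
    · by_cases hx : x ∈ K
      · rw [mul_comm]
        refine (ContinuousLinearMap.le_opNorm _ _).trans (mul_le_mul_of_nonneg_left ?_ (norm_nonneg _))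
        have hdivle : |VectorCalculus.divergence (g n) x| ≤ τ * ‖fderiv ℝ (g n) x‖ := by
          rw [divergence_eq_traceCLM, ← Real.norm_eq_abs]
          exact ContinuousLinearMap.le_opNorm _ _
        calc ‖fderiv ℝ (g n) x (g n x) - VectorCalculus.divergence (g n) x • g n x‖
            ≤ ‖fderiv ℝ (g n) x (g n x)‖ + ‖VectorCalculus.divergence (g n) x • g n x‖ :=
              norm_sub_le _ _
          _ ≤ ‖fderiv ℝ (g n) x‖ * ‖g n x‖ + |VectorCalculus.divergence (g n) x| * ‖g n x‖ := by
              rw [norm_smul, Real.norm_eq_abs]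
              exact add_le_add (ContinuousLinearMap.le_opNorm _ _) le_rfl
          _ ≤ (|B| + 1) * (|A| + 1) + τ * (|B| + 1) * (|A| + 1) := by
              have h1 := hDgK n x hx
              have h2 := hgK n x hx
              have h3 : |VectorCalculus.divergence (g n) x| ≤ τ * (|B| + 1) :=
                hdivle.trans (mul_le_mul_of_nonneg_left h1 hτ0)
              have h4 : 0 ≤ ‖g n x‖ := norm_nonneg _
              have h5 : 0 ≤ ‖fderiv ℝ (g n) x‖ := norm_nonneg _
              have h6 : 0 ≤ |VectorCalculus.divergence (g n) x| := abs_nonneg _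
              nlinarith [mul_le_mul h1 h2 h4 (by positivity), mul_le_mul h3 h2 h4 (by positivity)]
          _ = D₂ := by rw [hD₂]
      · simp [hDφK x hx]
    · by_cases hx : x ∈ K
      · have hcont : Continuous fun p : (EuclideanSpace ℝ (Fin 3) →L[ℝ] EuclideanSpace ℝ (Fin 3)) ×
            EuclideanSpace ℝ (Fin 3) => fderiv ℝ φ x (p.1 p.2 - traceCLM p.1 • p.2) := by
          refine (fderiv ℝ φ x).continuous.comp ?_
          exact (continuous_fst.clm_apply continuous_snd).sub
            ((traceCLM.continuous.comp continuous_fst).smul continuous_snd)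
        have h := (hcont.tendsto (fderiv ℝ W x, W x)).comp ((hDgx x hx).prodMk_nhds (hgx x hx))
        have h0 : traceCLM (fderiv ℝ W x) = 0 := by rw [← divergence_eq_traceCLM]; exact hdiv x
        simp only [Function.comp_def, h0, zero_smul, sub_zero] at h
        simpa only [divergence_eq_traceCLM] using h
      · simp only [hDφK x hx, zero_apply]
        exact tendsto_const_nhds
  have hL' : Tendsto (fun n => ∫ x, φ x * Q (fderiv ℝ (g n) x)) atTop
      (𝓝 (-∫ x, fderiv ℝ φ x (fderiv ℝ W x (W x)))) :=
    hR.neg.congr fun n => (hid n).symm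
  exact tendsto_nhds_unique hL hL'

/-! ## The whole-space identity for `C¹` fields -/

/-- **`∫‖curl W‖² = ∫|DW|²_F` for `C¹` divergence-free fields with `W, DW ∈ L²`.** Integrate the weak
identity against the radial cut-offs `χ_k` (`Literature.Analysis.Calculus.exists_scaled_cutoff`): the
left side tends to `∫(|DW|²_F − ‖curl W‖²)` and the right side `−∫ Dχ_k (DW W)` to `0`, its integrand
being dominated by `C₁(|DW|²_F + ‖W‖²)` and eventually zero at every point. [folklore] -/
theorem integral_norm_curl_sq_eq_of_contDiff_one (hW : ContDiff ℝ 1 W)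
    (hdiv : VectorCalculus.IsDivFree W) (hL2 : Integrable fun x => ‖W x‖ ^ 2)
    (hD : Integrable fun x => frobeniusNormSq (fderiv ℝ W x)) :
    ∫ x, ‖curl W x‖ ^ 2 = ∫ x, frobeniusNormSq (fderiv ℝ W x) := by
  have hWc : Continuous W := hW.continuous
  have hDWc : Continuous (fderiv ℝ W) := hW.continuous_fderiv one_ne_zero
  set F : EuclideanSpace ℝ (Fin 3) → ℝ := fun x => frobeniusNormSq (fderiv ℝ W x) with hF
  set Cu : EuclideanSpace ℝ (Fin 3) → ℝ := fun x => ‖curl W x‖ ^ 2 with hCu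
  have hFc : Continuous F := continuous_frobeniusNormSq_fderiv hW one_ne_zero
  have hFnn : ∀ x, 0 ≤ F x := fun x => frobeniusNormSq_nonneg _
  have hCuc : Continuous Cu := by
    have : Continuous (curl W) := by
      rw [curl_eq_curlCLM_comp]; exact curlCLM.continuous.comp hDWc
    exact (continuous_norm.comp this).pow 2
  have hCunn : ∀ x, 0 ≤ Cu x := fun x => sq_nonneg _
  have hCui : Integrable Cu := by
    refine (hD.const_mul 2).mono' hCuc.aestronglyMeasurable (ae_of_all _ fun x => ?_)
    rw [Real.norm_eq_abs, abs_of_nonneg (hCunn x)]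
    exact norm_curl_sq_le_two_mul_frobeniusNormSq W x
  obtain ⟨χ, C₁, hC₁, hχ⟩ :=
    Literature.Analysis.Calculus.exists_scaled_cutoff (E := EuclideanSpace ℝ (Fin 3))
  have hkpos : ∀ n : ℕ, (0 : ℝ) < (n : ℝ) + 1 := fun n => by positivity
  have hχC : ∀ n : ℕ, ContDiff ℝ 1 (χ ((n : ℝ) + 1)) := fun n => (hχ _ (hkpos n)).1
  have hχnn : ∀ (n : ℕ) y, 0 ≤ χ ((n : ℝ) + 1) y := fun n => (hχ _ (hkpos n)).2.1
  have hχle : ∀ (n : ℕ) y, χ ((n : ℝ) + 1) y ≤ 1 := fun n => (hχ _ (hkpos n)).2.2.1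
  have hχone : ∀ (n : ℕ) (y : EuclideanSpace ℝ (Fin 3)), ‖y‖ ≤ (n : ℝ) + 1 →
      χ ((n : ℝ) + 1) y = 1 := fun n => (hχ _ (hkpos n)).2.2.2.1
  have hχzero : ∀ (n : ℕ) (y : EuclideanSpace ℝ (Fin 3)), 2 * ((n : ℝ) + 1) ≤ ‖y‖ →
      χ ((n : ℝ) + 1) y = 0 := fun n => (hχ _ (hkpos n)).2.2.2.2.1
  have hDχ0 : ∀ (n : ℕ) (y : EuclideanSpace ℝ (Fin 3)), ‖y‖ < (n : ℝ) + 1 →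
      fderiv ℝ (χ ((n : ℝ) + 1)) y = 0 := fun n => (hχ _ (hkpos n)).2.2.2.2.2.1
  have hDχ : ∀ (n : ℕ) (y : EuclideanSpace ℝ (Fin 3)), (n : ℝ) + 1 ≤ ‖y‖ →
      ‖fderiv ℝ (χ ((n : ℝ) + 1)) y‖ ≤ 2 * C₁ / ‖y‖ := fun n => (hχ _ (hkpos n)).2.2.2.2.2.2
  have hχsupp : ∀ n : ℕ, HasCompactSupport (χ ((n : ℝ) + 1)) := fun n =>
    HasCompactSupport.intro (isCompact_closedBall (0 : EuclideanSpace ℝ (Fin 3)) (2 * ((n : ℝ) + 1)))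
      fun y hy => by
        rw [mem_closedBall_zero_iff, not_le] at hy
        exact hχzero n y hy.le
  have hDχbd : ∀ (n : ℕ) (y : EuclideanSpace ℝ (Fin 3)), ‖fderiv ℝ (χ ((n : ℝ) + 1)) y‖ ≤ 2 * C₁ := by
    intro n y
    by_cases hyk : ‖y‖ < (n : ℝ) + 1
    · rw [hDχ0 n y hyk, norm_zero]; positivity
    · push Not at hyk
      have hy1 : 1 ≤ ‖y‖ := le_trans (by have : (0:ℝ) ≤ n := Nat.cast_nonneg n; linarith) hyk
      exact (hDχ n y hyk).trans (div_le_self (by positivity) hy1)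
  set I : ℕ → ℝ := fun n => ∫ x, χ ((n : ℝ) + 1) x * (F x - Cu x) with hI
  set R : ℕ → ℝ := fun n => ∫ x, fderiv ℝ (χ ((n : ℝ) + 1)) x (fderiv ℝ W x (W x)) with hR
  have hE : ∀ n, I n = -R n := fun n =>
    integral_mul_frobeniusNormSq_sub_norm_curl_sq_eq hW hdiv (hχC n) (hχsupp n)
  have hIlim : Tendsto I atTop (𝓝 (∫ x, (F x - Cu x))) := by
    refine tendsto_integral_of_dominated_convergence (fun x => F x + Cu x) (fun n => ?_)
      (hD.add hCui) (fun n => ae_of_all _ fun x => ?_) (ae_of_all _ fun x => ?_)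
    · exact ((hχC n).continuous.mul (hFc.sub hCuc)).aestronglyMeasurable
    · rw [Real.norm_eq_abs, abs_mul, abs_of_nonneg (hχnn n x)]
      have h1 : |F x - Cu x| ≤ F x + Cu x :=
        abs_sub_le_iff.2 ⟨by linarith [hCunn x], by linarith [hFnn x]⟩
      calc χ ((n : ℝ) + 1) x * |F x - Cu x| ≤ 1 * (F x + Cu x) :=
            mul_le_mul (hχle n x) h1 (abs_nonneg _) zero_le_one
        _ = F x + Cu x := one_mul _
    · obtain ⟨N, hN⟩ := exists_nat_ge ‖x‖
      refine tendsto_atTop_of_eventually_const (i₀ := N) fun n hn => ?_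
      have hxn : ‖x‖ ≤ (n : ℝ) + 1 := by
        have : (N : ℝ) ≤ n := by exact_mod_cast hn
        linarith
      rw [hχone n x hxn, one_mul]
  have hRlim : Tendsto R atTop (𝓝 0) := by
    have hdom : Integrable fun x => C₁ * (F x + ‖W x‖ ^ 2) := (hD.add hL2).const_mul C₁
    have h := tendsto_integral_of_dominated_convergence (fun x => C₁ * (F x + ‖W x‖ ^ 2))
      (F := fun (n : ℕ) x => fderiv ℝ (χ ((n : ℝ) + 1)) x (fderiv ℝ W x (W x)))
      (f := fun _ => (0 : ℝ)) (fun n => ?_) hdom (fun n => ae_of_all _ fun x => ?_)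
      (ae_of_all _ fun x => ?_)
    · simpa only [integral_zero] using h
    · exact (((hχC n).continuous_fderiv one_ne_zero).clm_apply (hDWc.clm_apply hWc))
        |>.aestronglyMeasurable
    · have hDv2 : ‖fderiv ℝ W x‖ ^ 2 ≤ F x := sq_opNorm_le_frobeniusNormSq _
      calc ‖fderiv ℝ (χ ((n : ℝ) + 1)) x (fderiv ℝ W x (W x))‖
          ≤ ‖fderiv ℝ (χ ((n : ℝ) + 1)) x‖ * ‖fderiv ℝ W x (W x)‖ := ContinuousLinearMap.le_opNorm _ _
        _ ≤ (2 * C₁) * (‖fderiv ℝ W x‖ * ‖W x‖) :=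
            mul_le_mul (hDχbd n x) (ContinuousLinearMap.le_opNorm _ _) (norm_nonneg _) (by positivity)
        _ ≤ (2 * C₁) * ((‖fderiv ℝ W x‖ ^ 2 + ‖W x‖ ^ 2) / 2) := by
            gcongr
            linarith [two_mul_le_add_sq ‖fderiv ℝ W x‖ ‖W x‖]
        _ ≤ C₁ * (F x + ‖W x‖ ^ 2) := by nlinarith [hDv2, hC₁, sq_nonneg ‖W x‖]
    · obtain ⟨N, hN⟩ := exists_nat_ge ‖x‖
      refine tendsto_atTop_of_eventually_const (i₀ := N) fun n hn => ?_
      have hxn : ‖x‖ < (n : ℝ) + 1 := by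
        have : (N : ℝ) ≤ n := by exact_mod_cast hn
        linarith
      rw [hDχ0 n x hxn, zero_apply]
  have hI0 : Tendsto I atTop (𝓝 0) := by
    have h := hRlim.neg
    rw [neg_zero] at h
    exact h.congr fun n => (hE n).symm
  have hzero : ∫ x, (F x - Cu x) = 0 := tendsto_nhds_unique hIlim hI0
  rw [integral_sub hD hCui, sub_eq_zero] at hzero
  exact hzero.symm

/-- ★ **The palinstrophy identity in the registered class of S1.** For `u ∈ C²(ℝ³; ℝ³)` with
`ω = curl u ∈ L²` and `|∇ω|_F ∈ L²`: `∫‖curl ω‖² = ∫|∇ω|²_F`, i.e. `‖curl ω‖₂ = ‖∇ω‖₂` (the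
divergence-free `C¹` field `ω` has no compression part). This is `…AlignmentIdentity`'s
`integral_norm_curl_curl_sq_eq` with `u ∈ C³` lowered to `u ∈ C²`, the smoothness of the registered
`StretchingDepletion` class. [folklore] -/
theorem integral_norm_curl_curl_sq_eq_of_contDiff_two
    {u : EuclideanSpace ℝ (Fin 3) → EuclideanSpace ℝ (Fin 3)} (hu : ContDiff ℝ 2 u)
    (iZ : Integrable (fun x => ‖curl u x‖ ^ 2))
    (iA : Integrable (fun x => frobeniusNormSq (fderiv ℝ (curl u) x))) :
    ∫ x, ‖curl (curl u) x‖ ^ 2 = ∫ x, frobeniusNormSq (fderiv ℝ (curl u) x) :=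
  integral_norm_curl_sq_eq_of_contDiff_one (contDiff_one_curl_of_contDiff_two hu)
    (fun x => divergence_curl_eq_zero_holds u hu x) iZ iA

end Summit.NavierStokesRegularity.NavierStokesRegularity.Theorems.DepletionLadder.C1DivCurl

end
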